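import Literature.Geometry.Kaehler.TorusTransferOps
import Literature.Geometry.Kaehler.FrameSmoothOn
import Literature.NumberTheory.Transcendental.ComplexFormsSmoothProofs
import Literature.NumberTheory.Transcendental.KaehlerHodgeSmoothProofs
import Literature.NumberTheory.Transcendental.KaehlerHodgeLaplacianProofs
import Literature.NumberTheory.Transcendental.KaehlerHodgeOfRealProofs
import HarnessLib

/-!
# `∂̄`, `∂` and `∂̄* = -⋆∂⋆` read in a chart (Warner 6.32 for the `∂̄`-Laplacian)

F. W. Warner, *Foundations of Differentiable Manifolds and Lie Groups*, GTM 94 (1983), 6.32: the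
Laplacian "induces a partial differential operator `L` … via a coordinate system". For the
`∂̄`-Laplacian `Δ_∂̄ = ∂̄∂̄* + ∂̄*∂̄` of a Hermitian manifold (Voisin (2002), §5.1) the first-order
constituents are read in a holomorphic chart as `ChartOp1`s (`ChartOps`):

* the type projections `α ↦ α^{p,q}` are read by the *constant* operator `typeProjOp`
  (`represents_typeComponent`; holomorphic atlas: coordinate changes commute with `e^{iθ}`,
  `inChart_compContinuousLinearMap_tangentRotate_eq`), the complex Hodge star by the smooth field
  `cStarOp` (`represents_cHodgeStar`, from `MForm.inChart_hodgeStar_eq_op` of `FrameSmoothOn`),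
  `d` by `extDerivOp` (`ChartOps`);
* hence `∂̄ = ∑ Π_{p,q+1} ∘ d ∘ Π_{p,q}`, `∂`, and `∂̄* = -⋆∂⋆` are read by explicit operators
  `dolbeaultBarOp`, `dolbeaultOp`, `dolbeaultBarAdjointOp` (`represents_dolbeaultBar`, …), with
  smooth coefficients and commuting with `i` (`ChartOp1.CommI`, needed for the complex-linear
  torus coefficients of `TorusTransferOps`).

## References

* F. W. Warner, GTM 94 (1983), 6.32. [WarnerGTM94]
* C. Voisin, *Hodge Theory and Complex Algebraic Geometry I* (2002), §2.3.1, §5.1. [VoisinHodgeI2002]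
-/

noncomputable section

open scoped Manifold ContDiff Topology
open Bundle Set Filter Function Module
open Literature.NumberTheory.Transcendental

set_option maxSynthPendingDepth 2
set_option synthInstance.maxHeartbeats 100000

namespace Literature.Geometry.Kaehler

/-! ### Commutation of chart operators with `i` -/

section CommI

variable {E : Type*} [NormedAddCommGroup E] [NormedSpace ℝ E]
  {F F' F'' : Type*} [NormedAddCommGroup F] [NormedSpace ℂ F] [NormedAddCommGroup F'] [NormedSpace ℂ F']
  [NormedAddCommGroup F''] [NormedSpace ℂ F''] {k k' k'' : ℕ}

/-- The coefficients of a chart operator between complex-valued forms commute with multiplication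
by `i` (so that the transported torus coefficients are complex-linear). [folklore] -/
structure ChartOp1.CommI (Q : ChartOp1 E F F' k k') : Prop where
  /-- the derivative coefficient commutes with `i` -/
  B : ∀ y D, Q.B y (Complex.I • D) = Complex.I • Q.B y D
  /-- the value coefficient commutes with `i` -/
  C : ∀ y a, Q.C y (Complex.I • a) = Complex.I • Q.C y a

namespace ChartOp1.CommI

/-- `0` commutes with `i`. [folklore] -/
theorem zero : (0 : ChartOp1 E F F' k k').CommI := ⟨fun _ _ ↦ by simp, fun _ _ ↦ by simp⟩

/-- Sums. [folklore] -/
theorem add {Q Q' : ChartOp1 E F F' k k'} (h : Q.CommI) (h' : Q'.CommI) : (Q + Q').CommI :=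
  ⟨fun y D ↦ by simp [h.B, h'.B, smul_add], fun y a ↦ by simp [h.C, h'.C, smul_add]⟩

/-- Negations. [folklore] -/
theorem neg {Q : ChartOp1 E F F' k k'} (h : Q.CommI) : (-Q).CommI :=
  ⟨fun y D ↦ by simp [h.B], fun y a ↦ by simp [h.C]⟩

/-- Real scalar multiples. [folklore] -/
theorem smul (c : ℝ) {Q : ChartOp1 E F F' k k'} (h : Q.CommI) : (c • Q).CommI :=
  ⟨fun y D ↦ by simp [h.B, smul_comm c Complex.I], fun y a ↦ by simp [h.C, smul_comm c Complex.I]⟩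

/-- Finite sums. [folklore] -/
theorem finsetSum {ι : Type*} (s : Finset ι) {Q : ι → ChartOp1 E F F' k k'} (h : ∀ i ∈ s, (Q i).CommI) :
    (ChartOp1.finsetSum s Q).CommI :=
  ⟨fun y D ↦ by
    simp only [ChartOp1.finsetSum_B, FunLike.coe_sum, Finset.sum_apply, Finset.smul_sum]
    exact Finset.sum_congr rfl fun i hi ↦ (h i hi).B y D,
   fun y a ↦ by
    simp only [ChartOp1.finsetSum_C, FunLike.coe_sum, Finset.sum_apply, Finset.smul_sum]
    exact Finset.sum_congr rfl fun i hi ↦ (h i hi).C y a⟩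

/-- Zeroth-order operators with commuting coefficient. [folklore] -/
theorem ofCLM {C : E → ((E [⋀^Fin k]→L[ℝ] F) →L[ℝ] (E [⋀^Fin k']→L[ℝ] F'))}
    (hC : ∀ y a, C y (Complex.I • a) = Complex.I • C y a) : (ChartOp1.ofCLM C).CommI :=
  ⟨fun _ _ ↦ by simp, hC⟩

/-- The exterior-derivative operator commutes with `i`. [folklore] -/
theorem extDerivOp : (ChartOp1.extDerivOp E F k).CommI :=
  ⟨fun y D ↦ by
    change ContinuousAlternatingMap.alternatizeUncurryFinCLM ℝ E F (Complex.I • D) =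
      Complex.I • ContinuousAlternatingMap.alternatizeUncurryFinCLM ℝ E F D
    ext v
    simp only [ContinuousAlternatingMap.alternatizeUncurryFinCLM_apply,
      ContinuousAlternatingMap.alternatizeUncurryFin_apply, ContinuousAlternatingMap.smul_apply,
      Finset.smul_sum, FunLike.coe_smul, Pi.smul_apply]
    exact Finset.sum_congr rfl fun i _ ↦ smul_comm _ _ _,
   fun _ _ ↦ by simp [ChartOp1.extDerivOp]⟩

/-- `comp₀₁` with a commuting zeroth-order field. [folklore] -/
theorem comp₀₁ {C₁ : E → ((E [⋀^Fin k']→L[ℝ] F') →L[ℝ] (E [⋀^Fin k'']→L[ℝ] F''))}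
    (hC₁ : ∀ y a, C₁ y (Complex.I • a) = Complex.I • C₁ y a) {Q : ChartOp1 E F F' k k'} (h : Q.CommI) :
    (ChartOp1.comp₀₁ C₁ Q).CommI :=
  ⟨fun y D ↦ by simp [h.B, hC₁], fun y a ↦ by simp [h.C, hC₁]⟩

/-- **Derivatives of a field of maps commuting with `i` commute with `i`** (the condition is
closed and linear). [folklore] -/
theorem fderiv_apply_commute {C₂ : E → ((E [⋀^Fin k]→L[ℝ] F) →L[ℝ] (E [⋀^Fin k']→L[ℝ] F'))}
    (hC₂ : ∀ y a, C₂ y (Complex.I • a) = Complex.I • C₂ y a) (y : E) (v : E) (a : E [⋀^Fin k]→L[ℝ] F) :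
    fderiv ℝ C₂ y v (Complex.I • a) = Complex.I • fderiv ℝ C₂ y v a := by
  by_cases hd : DifferentiableAt ℝ C₂ y
  · set Θ : ((E [⋀^Fin k]→L[ℝ] F) →L[ℝ] (E [⋀^Fin k']→L[ℝ] F')) →L[ℝ] (E [⋀^Fin k']→L[ℝ] F') :=
      ContinuousLinearMap.apply ℝ (E [⋀^Fin k']→L[ℝ] F') (Complex.I • a) -
        Complex.I • ContinuousLinearMap.apply ℝ (E [⋀^Fin k']→L[ℝ] F') a with hΘ
    have h0 : (fun y ↦ Θ (C₂ y)) = fun _ ↦ 0 := funext fun y ↦ by simp [hΘ, hC₂]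
    have h1 : fderiv ℝ (fun y ↦ Θ (C₂ y)) y = Θ.comp (fderiv ℝ C₂ y) :=
      (Θ.hasFDerivAt.comp y hd.hasFDerivAt).fderiv
    have h2 : fderiv ℝ (fun y ↦ Θ (C₂ y)) y = 0 := by rw [h0]; exact fderiv_const_apply _
    have h3 := congrArg (fun T : E →L[ℝ] (E [⋀^Fin k']→L[ℝ] F') ↦ T v) (h1.symm.trans h2)
    simp only [ContinuousLinearMap.comp_apply, hΘ, zero_apply] at h3
    simpa [sub_eq_zero] using h3
  · simp [fderiv_zero_of_not_differentiableAt hd]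

/-- `comp₁₀` with a commuting zeroth-order field. [folklore] -/
theorem comp₁₀ {Q : ChartOp1 E F' F'' k' k''} (h : Q.CommI)
    {C₂ : E → ((E [⋀^Fin k]→L[ℝ] F) →L[ℝ] (E [⋀^Fin k']→L[ℝ] F'))}
    (hC₂ : ∀ y a, C₂ y (Complex.I • a) = Complex.I • C₂ y a) : (ChartOp1.comp₁₀ Q C₂).CommI :=
  ⟨fun y D ↦ by
    have h1 : (C₂ y).comp (Complex.I • D) = Complex.I • (C₂ y).comp D := by
      ext v; simp [hC₂]
    simp [h1, h.B],
   fun y a ↦ by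
    have h1 : (fderiv ℝ C₂ y).flip (Complex.I • a) = Complex.I • (fderiv ℝ C₂ y).flip a := by
      ext v; simp [fderiv_apply_commute hC₂]
    simp [hC₂, h.C, h1, h.B, smul_add]⟩

end ChartOp1.CommI

end CommI

/-! ### Finite sums of forms in a chart -/

section Sum

variable {E : Type*} [NormedAddCommGroup E] [NormedSpace ℝ E]
  {H : Type*} [TopologicalSpace H] {I : ModelWithCorners ℝ E H}
  {M : Type*} [TopologicalSpace M] [ChartedSpace H M]
  {F : Type*} [NormedAddCommGroup F] [NormedSpace ℝ F] {k : ℕ}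

/-- The representative of a finite sum of forms is the sum of the representatives. [folklore] -/
theorem MForm.inChart_finset_sum {ι : Type*} (s : Finset ι) (f : ι → MForm I M F k) (x₀ : M) :
    (∑ i ∈ s, f i).inChart x₀ = ∑ i ∈ s, (f i).inChart x₀ := by
  classical
  induction s using Finset.induction_on with
  | empty => simp [MForm.inChart_zero]
  | insert i s hi ih => rw [Finset.sum_insert hi, Finset.sum_insert hi, MForm.inChart_add, ih]

end Sum

/-! ### The type projections -/

section TypeProj

variable {E : Type*} [NormedAddCommGroup E] [NormedSpace ℂ E]
  {M : Type*} [TopologicalSpace M] [ChartedSpace E M] {k : ℕ}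

variable (E k) in
/-- Pre-composition of model covectors with the rotation `e^{iθ}` of `E`. [cite: VoisinHodgeI2002, §2.3.1] -/
def rotOp (θ : ℝ) : (E [⋀^Fin k]→L[ℝ] ℂ) →L[ℝ] (E [⋀^Fin k]→L[ℝ] ℂ) :=
  ContinuousAlternatingMap.compContinuousLinearMapCLM
    ((Complex.exp (θ * Complex.I) • ContinuousLinearMap.id ℂ E).restrictScalars ℝ)

variable (E k) in
/-- **The weight-`w` projection on model covectors** (the averaging formula of
`MForm.weightComponent`, frozen on `E`). [cite: VoisinHodgeI2002, §2.3.1] -/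
def weightProjOp (w : ℤ) : (E [⋀^Fin k]→L[ℝ] ℂ) →L[ℝ] (E [⋀^Fin k]→L[ℝ] ℂ) :=
  ((2 * k + 1 : ℕ) : ℂ)⁻¹ • ∑ j : Fin (2 * k + 1),
    Complex.exp (-(w * (2 * Real.pi * j / (2 * k + 1)) : ℝ) * Complex.I) • rotOp E k (2 * Real.pi * j / (2 * k + 1))

variable (E k) in
/-- **The type-`(p,q)` projection on model covectors** (`0` off the antidiagonal).
[cite: VoisinHodgeI2002, §2.3.1] -/
def typeProjOp (p q : ℕ) : (E [⋀^Fin k]→L[ℝ] ℂ) →L[ℝ] (E [⋀^Fin k]→L[ℝ] ℂ) :=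
  if p + q = k then weightProjOp E k (p - q : ℤ) else 0

/-- The rotation operator commutes with `i` (it acts on the arguments). [folklore] -/
theorem rotOp_commute (θ : ℝ) (a : E [⋀^Fin k]→L[ℝ] ℂ) : rotOp E k θ (Complex.I • a) = Complex.I • rotOp E k θ a := by
  ext v; simp [rotOp]

/-- The weight projection commutes with `i`. [folklore] -/
theorem weightProjOp_commute (w : ℤ) (a : E [⋀^Fin k]→L[ℝ] ℂ) :
    weightProjOp E k w (Complex.I • a) = Complex.I • weightProjOp E k w a := by
  simp only [weightProjOp, FunLike.coe_smul, Pi.smul_apply, FunLike.coe_sum, Finset.sum_apply,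
    rotOp_commute, Finset.smul_sum]
  refine Finset.sum_congr rfl fun j _ ↦ ?_
  rw [smul_smul, smul_smul, smul_smul, smul_smul]
  congr 1
  ring

/-- The type projection commutes with `i`. [folklore] -/
theorem typeProjOp_commute (p q : ℕ) (a : E [⋀^Fin k]→L[ℝ] ℂ) :
    typeProjOp E k p q (Complex.I • a) = Complex.I • typeProjOp E k p q a := by
  unfold typeProjOp
  split_ifs
  · exact weightProjOp_commute _ a
  · simp

variable [IsManifold 𝓘(ℂ, E) ω M] [IsManifold 𝓘(ℝ, E) ∞ M]

/-- **The weight components are read by the constant operator `weightProjOp`** (holomorphic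
atlas: `inChart_compContinuousLinearMap_tangentRotate_eq`). [cite: VoisinHodgeI2002, §2.3.1] -/
theorem represents_weightComponent (p₀ : M) (w : ℤ) :
    ChartOp1.Represents p₀ (fun α : MForm 𝓘(ℝ, E) M ℂ k ↦ α.weightComponent w)
      (ChartOp1.ofCLM fun _ ↦ weightProjOp E k w) :=
  ⟨fun β _ y hy ↦ by
    rw [ChartOp1.applyAt_ofCLM, MForm.weightComponent_eq_sum_compContinuousLinearMap,
      MForm.inChart_smul_complex, Pi.smul_apply, MForm.inChart_finset_sum, Finset.sum_apply]
    simp only [weightProjOp, FunLike.coe_smul, Pi.smul_apply, FunLike.coe_sum, Finset.sum_apply]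
    congr 1
    refine Finset.sum_congr rfl fun j _ ↦ ?_
    rw [MForm.inChart_smul_complex, Pi.smul_apply, inChart_compContinuousLinearMap_tangentRotate_eq _ β hy]
    simp [rotOp]⟩

/-- **The type components are read by the constant operator `typeProjOp`.** [cite: VoisinHodgeI2002, §2.3.1] -/
theorem represents_typeComponent (p₀ : M) (p q : ℕ) :
    ChartOp1.Represents p₀ (fun α : MForm 𝓘(ℝ, E) M ℂ k ↦ α.typeComponent p q)
      (ChartOp1.ofCLM fun _ ↦ typeProjOp E k p q) := by
  unfold MForm.typeComponent typeProjOp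
  split_ifs with h
  · exact represents_weightComponent p₀ _
  · refine ⟨fun β _ y hy ↦ ?_⟩
    rw [MForm.inChart_zero, ChartOp1.applyAt_ofCLM]
    rfl

end TypeProj

/-! ### The complex Hodge star -/

section Post

variable {E : Type*} [NormedAddCommGroup E] [NormedSpace ℝ E] {k : ℕ}

variable (E k) in
/-- Post-composition of model covectors with `Re`. [folklore] -/
def rePost : (E [⋀^Fin k]→L[ℝ] ℂ) →L[ℝ] (E [⋀^Fin k]→L[ℝ] ℝ) :=
  ContinuousLinearMap.compContinuousAlternatingMapCLM ℝ E ℂ ℝ (Fin k) Complex.reCLM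

variable (E k) in
/-- Post-composition of model covectors with `Im`. [folklore] -/
def imPost : (E [⋀^Fin k]→L[ℝ] ℂ) →L[ℝ] (E [⋀^Fin k]→L[ℝ] ℝ) :=
  ContinuousLinearMap.compContinuousAlternatingMapCLM ℝ E ℂ ℝ (Fin k) Complex.imCLM

variable (E k) in
/-- Post-composition of real model covectors with `ℝ ⊆ ℂ`. [folklore] -/
def ofRealPost : (E [⋀^Fin k]→L[ℝ] ℝ) →L[ℝ] (E [⋀^Fin k]→L[ℝ] ℂ) :=
  ContinuousLinearMap.compContinuousAlternatingMapCLM ℝ E ℝ ℂ (Fin k) Complex.ofRealCLM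

/-- Values of `rePost`. [folklore] -/
@[simp] theorem rePost_apply (a : E [⋀^Fin k]→L[ℝ] ℂ) : rePost E k a = Complex.reCLM.compContinuousAlternatingMap a := rfl
/-- Values of `imPost`. [folklore] -/
@[simp] theorem imPost_apply (a : E [⋀^Fin k]→L[ℝ] ℂ) : imPost E k a = Complex.imCLM.compContinuousAlternatingMap a := rfl
/-- Values of `ofRealPost`. [folklore] -/
@[simp] theorem ofRealPost_apply (a : E [⋀^Fin k]→L[ℝ] ℝ) : ofRealPost E k a = Complex.ofRealCLM.compContinuousAlternatingMap a := rfl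

/-- `Re (i a) = -Im a`. [folklore] -/
theorem rePost_I_smul (a : E [⋀^Fin k]→L[ℝ] ℂ) : rePost E k (Complex.I • a) = -imPost E k a := by
  ext v; simp

/-- `Im (i a) = Re a`. [folklore] -/
theorem imPost_I_smul (a : E [⋀^Fin k]→L[ℝ] ℂ) : imPost E k (Complex.I • a) = rePost E k a := by
  ext v; simp

end Post

section Star

variable {E : Type*} [NormedAddCommGroup E] [NormedSpace ℂ E] [FiniteDimensional ℂ E]
  {n : ℕ} [Fact (finrank ℝ E = n)]
  {M : Type*} [TopologicalSpace M] [ChartedSpace E M] [IsManifold 𝓘(ℝ, E) ∞ M]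
  [RiemannianBundle (fun x : M ↦ TangentSpace 𝓘(ℝ, E) x)]
  (o : (x : M) → Orientation ℝ (TangentSpace 𝓘(ℝ, E) x) (Fin n)) {k m : ℕ}

/-- **The complex Hodge star in the chart at `x₀` as a field of real-linear operators**:
`a ↦ ⋆(Re a) + i ⋆(Im a)` with the real chart operator `hodgeStarChartOp` of `FrameSmoothOn`.
[cite: WarnerGTM94, 4.10 (6), p. 150] -/
def cStarOp (h : k + m = n) (x₀ : M) (y : E) : (E [⋀^Fin k]→L[ℝ] ℂ) →L[ℝ] (E [⋀^Fin m]→L[ℝ] ℂ) :=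
  (ofRealPost E m).comp ((hodgeStarChartOp (I := 𝓘(ℝ, E)) o h x₀ y).comp (rePost E k)) +
    Complex.I • ((ofRealPost E m).comp ((hodgeStarChartOp (I := 𝓘(ℝ, E)) o h x₀ y).comp (imPost E k)))

/-- Values of `cStarOp`. [folklore] -/
theorem cStarOp_apply (h : k + m = n) (x₀ : M) (y : E) (a : E [⋀^Fin k]→L[ℝ] ℂ) :
    cStarOp o h x₀ y a =
      Complex.ofRealCLM.compContinuousAlternatingMap
          (hodgeStarChartOp (I := 𝓘(ℝ, E)) o h x₀ y (Complex.reCLM.compContinuousAlternatingMap a)) +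
        Complex.I • Complex.ofRealCLM.compContinuousAlternatingMap
          (hodgeStarChartOp (I := 𝓘(ℝ, E)) o h x₀ y (Complex.imCLM.compContinuousAlternatingMap a)) := rfl

/-- The complex Hodge star operator commutes with `i`. [folklore] -/
theorem cStarOp_commute (h : k + m = n) (x₀ : M) (y : E) (a : E [⋀^Fin k]→L[ℝ] ℂ) :
    cStarOp o h x₀ y (Complex.I • a) = Complex.I • cStarOp o h x₀ y a := by
  have hre := rePost_I_smul (E := E) (k := k) a
  have him := imPost_I_smul (E := E) (k := k) a
  simp only [rePost_apply, imPost_apply] at hre him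
  have hneg : ∀ x : E [⋀^Fin m]→L[ℝ] ℝ, Complex.ofRealCLM.compContinuousAlternatingMap (-x) =
      -Complex.ofRealCLM.compContinuousAlternatingMap x := fun x ↦ (ofRealPost E m).map_neg x
  rw [cStarOp_apply, cStarOp_apply, hre, him, map_neg, hneg, smul_add, smul_smul, Complex.I_mul_I,
    neg_one_smul]
  abel

/-- **The complex Hodge star is read by `cStarOp`** (`MForm.inChart_hodgeStar_eq_op` on real and
imaginary parts). [cite: WarnerGTM94, 4.10 (6), p. 150] -/
theorem represents_cHodgeStar (h : k + m = n) (p₀ : M) :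
    ChartOp1.Represents p₀ (MForm.cHodgeStar o h : MForm 𝓘(ℝ, E) M ℂ k → MForm 𝓘(ℝ, E) M ℂ m)
      (ChartOp1.ofCLM (cStarOp o h p₀)) :=
  ⟨fun β _ y hy ↦ by
    rw [ChartOp1.applyAt_ofCLM, cStarOp_apply, MForm.cHodgeStar_apply, MForm.inChart_add, Pi.add_apply,
      MForm.inChart_smul_complex, Pi.smul_apply, MForm.inChart_ofReal, MForm.inChart_ofReal]
    dsimp only
    rw [MForm.inChart_hodgeStar_eq_op o h β.re hy, MForm.inChart_hodgeStar_eq_op o h β.im hy]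
    rfl⟩

variable [IsContMDiffRiemannianBundle 𝓘(ℝ, E) ∞ E (fun x : M ↦ TangentSpace 𝓘(ℝ, E) x)]

/-- **The complex Hodge star operator is smooth on the chart target** (smooth metric, smooth
volume form; `contDiffOn_hodgeStarChartOp`). [cite: WarnerGTM94, 4.10 (6), p. 150] -/
theorem contDiffOn_cStarOp (ho : IsSmoothForm (riemannianVolumeForm o)) (h : k + m = n) (x₀ : M) :
    ContDiffOn ℝ ∞ (cStarOp o h x₀) (extChartAt 𝓘(ℝ, E) x₀).target := by
  have hS := contDiffOn_hodgeStarChartOp (I := 𝓘(ℝ, E)) o h x₀ (ho.contDiffOn_inChart x₀)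
  exact (contDiffOn_const.clm_comp (hS.clm_comp contDiffOn_const)).add
    ((contDiffOn_const.clm_comp (hS.clm_comp contDiffOn_const)).const_smul Complex.I)

end Star

/-! ### `∂̄`, `∂`, `∂̄*` -/

section Dolbeault

variable {E : Type*} [NormedAddCommGroup E] [NormedSpace ℂ E]
  {M : Type*} [TopologicalSpace M] [ChartedSpace E M] {k : ℕ}

variable (E k) in
/-- **`∂̄` read in a chart**: `∑_{p+q=k} Π_{p,q+1} ∘ d ∘ Π_{p,q}` with constant projections.
[cite: VoisinHodgeI2002, §2.3.1] -/
def dolbeaultBarOp : ChartOp1 E ℂ ℂ k (k + 1) :=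
  ChartOp1.finsetSum (Finset.antidiagonal k) fun pq ↦
    ChartOp1.comp₀₁ (fun _ ↦ typeProjOp E (k + 1) pq.1 (pq.2 + 1))
      (ChartOp1.comp₁₀ (ChartOp1.extDerivOp E ℂ k) fun _ ↦ typeProjOp E k pq.1 pq.2)

variable (E k) in
/-- **`∂` read in a chart**: `∑_{p+q=k} Π_{p+1,q} ∘ d ∘ Π_{p,q}`. [cite: VoisinHodgeI2002, §2.3.1] -/
def dolbeaultOp : ChartOp1 E ℂ ℂ k (k + 1) :=
  ChartOp1.finsetSum (Finset.antidiagonal k) fun pq ↦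
    ChartOp1.comp₀₁ (fun _ ↦ typeProjOp E (k + 1) (pq.1 + 1) pq.2)
      (ChartOp1.comp₁₀ (ChartOp1.extDerivOp E ℂ k) fun _ ↦ typeProjOp E k pq.1 pq.2)

/-- `∂̄` read in a chart commutes with `i`. [folklore] -/
theorem commI_dolbeaultBarOp : (dolbeaultBarOp E k).CommI :=
  ChartOp1.CommI.finsetSum _ fun _ _ ↦ ChartOp1.CommI.comp₀₁ (fun _ a ↦ typeProjOp_commute _ _ a)
    (ChartOp1.CommI.extDerivOp.comp₁₀ fun _ a ↦ typeProjOp_commute _ _ a)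

/-- `∂` read in a chart commutes with `i`. [folklore] -/
theorem commI_dolbeaultOp : (dolbeaultOp E k).CommI :=
  ChartOp1.CommI.finsetSum _ fun _ _ ↦ ChartOp1.CommI.comp₀₁ (fun _ a ↦ typeProjOp_commute _ _ a)
    (ChartOp1.CommI.extDerivOp.comp₁₀ fun _ a ↦ typeProjOp_commute _ _ a)

variable [FiniteDimensional ℂ E]

/-- `∂̄` read in a chart has smooth (constant) coefficients on any open set. [folklore] -/
theorem smoothOn_dolbeaultBarOp {s : Set E} (hs : IsOpen s) : (dolbeaultBarOp E k).SmoothOn s :=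
  ChartOp1.SmoothOn.finsetSum _ fun _ _ ↦ ChartOp1.SmoothOn.comp₀₁ contDiffOn_const
    (ChartOp1.SmoothOn.comp₁₀ hs (ChartOp1.smoothOn_extDerivOp s) contDiffOn_const)

/-- `∂` read in a chart has smooth (constant) coefficients on any open set. [folklore] -/
theorem smoothOn_dolbeaultOp {s : Set E} (hs : IsOpen s) : (dolbeaultOp E k).SmoothOn s :=
  ChartOp1.SmoothOn.finsetSum _ fun _ _ ↦ ChartOp1.SmoothOn.comp₀₁ contDiffOn_const
    (ChartOp1.SmoothOn.comp₁₀ hs (ChartOp1.smoothOn_extDerivOp s) contDiffOn_const)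

variable [IsManifold 𝓘(ℂ, E) ω M] [IsManifold 𝓘(ℝ, E) ∞ M]

omit [FiniteDimensional ℂ E] in
/-- **`∂̄` is read by `dolbeaultBarOp`.** [cite: VoisinHodgeI2002, §2.3.1] -/
theorem represents_dolbeaultBar (p₀ : M) :
    ChartOp1.Represents p₀ (dolbeaultBar : MForm 𝓘(ℝ, E) M ℂ k → MForm 𝓘(ℝ, E) M ℂ (k + 1))
      (dolbeaultBarOp E k) := by
  have h : (dolbeaultBar : MForm 𝓘(ℝ, E) M ℂ k → MForm 𝓘(ℝ, E) M ℂ (k + 1)) = fun α ↦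
      ∑ pq ∈ Finset.antidiagonal k, (mextDeriv (α.typeComponent pq.1 pq.2)).typeComponent pq.1 (pq.2 + 1) :=
    rfl
  rw [h]
  exact ChartOp1.Represents.finsetSum _ fun pq _ ↦
    (represents_typeComponent p₀ pq.1 (pq.2 + 1)).comp₀₁
      (ChartOp1.Represents.mextDeriv.comp₁₀ (represents_typeComponent p₀ pq.1 pq.2) contDiffOn_const
        fun β hβ ↦ hβ.typeComponent _ _)
      fun β hβ ↦ (hβ.typeComponent _ _).mextDeriv

omit [FiniteDimensional ℂ E] in
/-- **`∂` is read by `dolbeaultOp`.** [cite: VoisinHodgeI2002, §2.3.1] -/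
theorem represents_dolbeault (p₀ : M) :
    ChartOp1.Represents p₀ (dolbeault : MForm 𝓘(ℝ, E) M ℂ k → MForm 𝓘(ℝ, E) M ℂ (k + 1))
      (dolbeaultOp E k) := by
  have h : (dolbeault : MForm 𝓘(ℝ, E) M ℂ k → MForm 𝓘(ℝ, E) M ℂ (k + 1)) = fun α ↦
      ∑ pq ∈ Finset.antidiagonal k, (mextDeriv (α.typeComponent pq.1 pq.2)).typeComponent (pq.1 + 1) pq.2 :=
    rfl
  rw [h]
  exact ChartOp1.Represents.finsetSum _ fun pq _ ↦
    (represents_typeComponent p₀ (pq.1 + 1) pq.2).comp₀₁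
      (ChartOp1.Represents.mextDeriv.comp₁₀ (represents_typeComponent p₀ pq.1 pq.2) contDiffOn_const
        fun β hβ ↦ hβ.typeComponent _ _)
      fun β hβ ↦ (hβ.typeComponent _ _).mextDeriv

variable {n : ℕ} [Fact (finrank ℝ E = n)] [RiemannianBundle (fun x : M ↦ TangentSpace 𝓘(ℝ, E) x)]
  (o : (x : M) → Orientation ℝ (TangentSpace 𝓘(ℝ, E) x) (Fin n)) {m : ℕ}

/-- **`∂̄* = -⋆∂⋆` read in the chart at `p₀`**: `-(⋆' ∘ (∂ ∘ ⋆))` with the smooth star fields.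
[cite: WarnerGTM94, 6.32] -/
def dolbeaultBarAdjointOp (h : (k + 1) + m = n) (p₀ : M) : ChartOp1 E ℂ ℂ (k + 1) k :=
  -ChartOp1.comp₀₁ (cStarOp o (show (m + 1) + k = n by omega) p₀)
    (ChartOp1.comp₁₀ (dolbeaultOp E m) (cStarOp o h p₀))

omit [IsManifold 𝓘(ℂ, E) ω M] in
/-- `∂̄*` read in a chart commutes with `i`. [folklore] -/
theorem commI_dolbeaultBarAdjointOp (h : (k + 1) + m = n) (p₀ : M) : (dolbeaultBarAdjointOp o h p₀).CommI :=
  (ChartOp1.CommI.comp₀₁ (fun y a ↦ cStarOp_commute o _ p₀ y a)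
    (commI_dolbeaultOp.comp₁₀ fun y a ↦ cStarOp_commute o h p₀ y a)).neg

variable [IsContMDiffRiemannianBundle 𝓘(ℝ, E) ∞ E (fun x : M ↦ TangentSpace 𝓘(ℝ, E) x)]

omit [IsManifold 𝓘(ℂ, E) ω M] in
/-- `∂̄*` read in the chart at `p₀` has smooth coefficients on the chart target. [folklore] -/
theorem smoothOn_dolbeaultBarAdjointOp (ho : IsSmoothForm (riemannianVolumeForm o)) (h : (k + 1) + m = n)
    (p₀ : M) : (dolbeaultBarAdjointOp o h p₀).SmoothOn (extChartAt 𝓘(ℝ, E) p₀).target :=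
  (ChartOp1.SmoothOn.comp₀₁ (contDiffOn_cStarOp o ho _ p₀)
    (ChartOp1.SmoothOn.comp₁₀ (isOpen_extChartAt_target p₀) (smoothOn_dolbeaultOp (isOpen_extChartAt_target p₀))
      (contDiffOn_cStarOp o ho h p₀))).neg

/-- **`∂̄*` is read by `dolbeaultBarAdjointOp`** (smooth metric and volume form).
[cite: WarnerGTM94, 6.32] -/
theorem represents_dolbeaultBarAdjoint (ho : IsSmoothForm (riemannianVolumeForm o)) (h : (k + 1) + m = n)
    (p₀ : M) :
    ChartOp1.Represents p₀ (dolbeaultBarAdjoint o h : MForm 𝓘(ℝ, E) M ℂ (k + 1) → MForm 𝓘(ℝ, E) M ℂ k)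
      (dolbeaultBarAdjointOp o h p₀) := by
  have hh : (dolbeaultBarAdjoint o h : MForm 𝓘(ℝ, E) M ℂ (k + 1) → MForm 𝓘(ℝ, E) M ℂ k) = fun α ↦
      -MForm.cHodgeStar o (show (m + 1) + k = n by omega) (dolbeault (MForm.cHodgeStar o h α)) :=
    rfl
  rw [hh]
  exact ((represents_cHodgeStar o _ p₀).comp₀₁
    ((represents_dolbeault p₀).comp₁₀ (represents_cHodgeStar o h p₀) (contDiffOn_cStarOp o ho h p₀)
      fun β hβ ↦ IsSmoothForm.cHodgeStar o ho h hβ)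
    fun β hβ ↦ (IsSmoothForm.cHodgeStar o ho h hβ).dolbeault).neg

end Dolbeault

end Literature.Geometry.Kaehler
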